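import Summits.CriticalPhenomena.Ising3DConformalLimit.Theses.FKParityRobustness
import Summits.CriticalPhenomena.Ising3DConformalLimit.Theorems.FKParityRobustnessDefs
import Summits.CriticalPhenomena.Ising3DConformalLimit.Theorems.FKParityRobustnessParityRobustMergingEvenSubgraphCount
import Summits.CriticalPhenomena.Ising3DConformalLimit.Theorems.FKParityRobustnessParityRobustMergingGrimmettJanson
import Summits.CriticalPhenomena.Ising3DConformalLimit.Theorems.FKParityRobustnessParityRobustMergingFKTransfer
import Literature.Probability.LatticeModels.LoopO1
import Literature.Probability.LatticeModels.RandomCluster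
import Literature.Probability.LatticeModels.RandomClusterFKG
import Literature.Probability.LatticeModels.FKIsingRSWProofs
import Literature.Combinatorics.SimpleGraph.CycleSpaceSeparators
import HarnessLib

/-!
# FK → loop transfer in the falsifying direction: `¬ SourceTrailsMeet → ¬ (ParityRobustMerging ∧ FKFourConnectivity)`
# (negative lemma for crux `FKFourConnectivity`, stmt-CriticalPhenomena-11254, and support `ParityRobustMerging`, 11253)

Route `FKParityRobustness` (rev ≤ 3 spine "X = BLOB ∧ P4 ∧ ML"; in rev ≥ 4 BLOB = `ParityRobustMerging`
is a support and P4 = `FKFourConnectivity` the rank-3 crux).  This theorem-only file proves, with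
finite sums only, that on every finite graph, at every `β ≥ 0`, for distinct sources, BLOB's
inequality `c_B·φ[all aᵢ joined] ≤ ∫ u_a dφ` and P4's inequality `c_P·φ(a₀↔a₁)φ(a₂↔a₃) ≤ φ[all aᵢ
joined]` (free FK-Ising `φ = φ_{G,1−e^{−2β},2}`) force the loop-O(1) inequality of `SourceTrailsMeet`
(item 11255) with `c = c_B c_P`:  `c_B c_P · Z_t({a₀,a₁}) Z_t({a₂,a₃}) ≤ Z_t(∅) Z_t(A; all joined)`,
`t = tanh β` (`loop_bound_of_fk_bounds`).  The tool is the sourced Grimmett–Janson identity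
(`grimmettJanson_identity` with `card_evenSubgraphs_mul_two_pow`, landed by the 11253 line) read three
ways: `A = ∅` (`rcPartitionFunction_two_eq_loop`: `Z_RC = 2^{|V|}(1−p/2)^{|E|}·Z_t(∅)`), `A = {x,y}`
(`rcMeasure_real_openConn_mul_Z`: `φ(x↔y)·Z_RC = 2^{|V|}(1−p/2)^{|E|}·Z_t({x,y})` for `x ≠ y`, via
`tJoins_pair_nonempty_iff`) and `A = {aᵢ}, P = C` (`integral_u_mul_Z`:
`∫u_a dφ·Z_RC = 2^{|V|}(1−p/2)^{|E|}·Z_t(A;C)`, the crux's `Finset`-monad coercion included).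
At the box graph of `Λ_N ⊂ ℤ³`, `β = β_c(3)`:

* `not_blob_and_p4_of_not_sourceTrailsMeet : ¬ SourceTrailsMeet → ¬ (ParityRobustMerging ∧ FKFourConnectivity)`.

So BLOB and P4 die TOGETHER with the one loop quantity `R(l) = Z(∅)Z(A_l;C)/(Z(01)Z(23))`
(`= P_C(l)·⟨σ_{A_l}⟩/G²`, `P_C = ℓ^{A_l}[all four sources in one component]`, factor in `[1,3]`), whose
decay `l^{3−x₄}`, `x₄ = Δ_{T₄}(O(n→1)) ≈ 3.23 > 3`, is the watermelon verdict recorded in the route text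
(rev 4) and probed by the 11253 line's Monte Carlo.  The converse reading of the same dictionary (loop
inequality ⇒ `c·φφ ≤ ∫u ≤ φ[all joined]`, so `SourceTrailsMeet → FKFourConnectivity`) is the companion
file `LoopTransferConverse.lean`.  References: G. Grimmett, S. Janson, *Random even graphs*, Electron.
J. Combin. 16 (2009), Thm 3.1 [GrimmettJanson2007]; U. T. Hansen, J. Jiang, F. R. Klausen,
arXiv:2506.10765, §2 [HansenJiangKlausen2025].
-/

noncomputable section

open MeasureTheory Finset
open Literature.Probability.LatticeModels
open Literature.Combinatorics.SimpleGraph.CycleSpace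
open Summit.CriticalPhenomena.Ising3DConformalLimit.Cruxes.ParityRobustMerging.PlaquetteXorSurgery

namespace Summit.CriticalPhenomena.Ising3DConformalLimit.Theorems.FKFourConnectivity.Negative

open scoped Classical

section General

variable {V : Type*} [Fintype V] [DecidableEq V] (G : SimpleGraph V) [DecidableRel G.Adj]

/-- The FK-Ising partition function in loop-O(1) form (Grimmett–Janson at `A = ∅`):
`Z_RC(p, 2) = 2^{|V|} (1 − p/2)^{|E|} · ∑_{F even ⊆ E} (p/(2−p))^{|F|}`. [cite: GrimmettJanson2007, Thm 3.1] -/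
theorem rcPartitionFunction_two_eq_loop {p : ℝ} (hp : p ∈ Set.Icc (0 : ℝ) 1) :
    rcPartitionFunction G p 2 ∅ =
      2 ^ Fintype.card V * (1 - p / 2) ^ #G.edgeFinset *
        ∑ F ∈ tJoins G Set.univ (∅ : Finset V), (p / (2 - p)) ^ #F := by
  have hGJ := grimmettJanson_identity G (fun ω hω => card_evenSubgraphs_mul_two_pow G ω hω) hp
    (∅ : Finset V) (fun _ => True)
  simp only [Finset.filter_true] at hGJ
  rw [← hGJ]
  unfold rcPartitionFunction
  refine Finset.sum_congr rfl fun ω _ => ?_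
  have hE : (#(evenSubgraphs G (↑ω : Set (Sym2 V))) : ℝ) ≠ 0 :=
    Nat.cast_ne_zero.2 (Finset.card_pos.2 ⟨∅, empty_mem_evenSubgraphs G _⟩).ne'
  rw [show tJoins G (↑ω : Set (Sym2 V)) ∅ = evenSubgraphs G (↑ω : Set (Sym2 V)) from rfl,
    div_self hE, mul_one]

/-- `T`-joins with terminal set `{x, y}` exist inside `ω ⊆ E(G)` iff `x ↔ y` in `(V, ω)` (`x ≠ y`):
a path gives one (`odd_edgeDeg_walkEdges_iff`), and conversely the odd vertex `x` of a `T`-join is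
joined to the only other odd vertex `y` (handshake in a component, `exists_reachable_odd_of_odd`). [folklore] -/
theorem tJoins_pair_nonempty_iff (ω : Finset (Sym2 V)) (hω : ω ⊆ G.edgeFinset) {x y : V} (hxy : x ≠ y) :
    (tJoins G (↑ω : Set (Sym2 V)) {x, y}).Nonempty ↔
      (SimpleGraph.fromEdgeSet (↑ω : Set (Sym2 V))).Reachable x y := by
  constructor
  · rintro ⟨F, hF⟩
    obtain ⟨hFG, hFω, hpar⟩ := (mem_tJoins G).1 hF
    have hFE : ∀ e ∈ F, ¬ e.IsDiag := fun e he =>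
      SimpleGraph.not_isDiag_of_mem_edgeSet G (SimpleGraph.mem_edgeFinset.1 (hFG he))
    have hx : Odd (edgeDeg F x) := (hpar x).2 (by simp)
    obtain ⟨w, hwx, hreach, hwodd⟩ := exists_reachable_odd_of_odd F hFE hx
    have hw : w ∈ ({x, y} : Finset V) := (hpar w).1 hwodd
    have hwy : w = y := by
      rcases Finset.mem_insert.1 hw with h | h
      · exact absurd h hwx
      · exact Finset.mem_singleton.1 h
    subst hwy
    exact hreach.mono (SimpleGraph.fromEdgeSet_mono hFω)
  · rintro ⟨p⟩
    have hsub : ∀ e ∈ walkEdges p.toPath.1, e ∈ ω := by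
      intro e he
      have h := mem_edgeSet_of_mem_walkEdges p.toPath.1 he
      rw [SimpleGraph.edgeSet_fromEdgeSet] at h
      exact Finset.mem_coe.1 h.1
    refine ⟨walkEdges p.toPath.1, (mem_tJoins G).2 ⟨fun e he => hω (hsub e he),
      fun e he => Finset.mem_coe.2 (hsub e (Finset.mem_coe.1 he)), fun w => ?_⟩⟩
    have key := odd_edgeDeg_walkEdges_iff p.toPath.2 hxy w
    simp only [edgeDeg] at key
    rw [key]
    simp

/-- **Two-point dictionary in loop form** (Edwards–Sokal ∘ high-temperature expansion, here obtained
from the sourced Grimmett–Janson identity at `A = {x, y}`): for `x ≠ y` and `0 ≤ p ≤ 1`,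
`φ_{G,p,2}(x ↔ y) · Z_RC = 2^{|V|} (1 − p/2)^{|E|} · ∑_{F ⊆ E, ∂F = {x,y}} (p/(2−p))^{|F|}`. [cite: GrimmettJanson2007, Thm 3.1] -/
theorem rcMeasure_real_openConn_mul_Z {p : ℝ} (hp : p ∈ Set.Icc (0 : ℝ) 1) {x y : V} (hxy : x ≠ y) :
    (rcMeasure G p 2 ∅).real (Literature.Probability.Percolation.openConn x y) *
        rcPartitionFunction G p 2 ∅ =
      2 ^ Fintype.card V * (1 - p / 2) ^ #G.edgeFinset *
        ∑ F ∈ tJoins G Set.univ ({x, y} : Finset V), (p / (2 - p)) ^ #F := by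
  have h2 : (0 : ℝ) < 2 := two_pos
  have hZ := rcPartitionFunction_pos G hp h2 (∅ : Set V)
  have hGJ := grimmettJanson_identity G (fun ω hω => card_evenSubgraphs_mul_two_pow G ω hω) hp
    ({x, y} : Finset V) (fun _ => True)
  simp only [Finset.filter_true] at hGJ
  rw [← hGJ, rcMeasure_real_apply G hp h2 (∅ : Set V), Finset.sum_mul]
  refine Finset.sum_congr rfl fun ω hω => ?_
  have hωE : ω ⊆ G.edgeFinset := Finset.mem_powerset.1 hω
  by_cases hr : (SimpleGraph.fromEdgeSet (↑ω : Set (Sym2 V))).Reachable x y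
  · have hmem : (↑ω : Literature.Probability.Percolation.BondConfig V) ∈
        Literature.Probability.Percolation.openConn x y := hr
    obtain ⟨F₀, hF₀⟩ := (tJoins_pair_nonempty_iff G ω hωE hxy).2 hr
    have hE : (#(evenSubgraphs G (↑ω : Set (Sym2 V))) : ℝ) ≠ 0 :=
      Nat.cast_ne_zero.2 (Finset.card_pos.2 ⟨∅, empty_mem_evenSubgraphs G _⟩).ne'
    rw [if_pos hmem, card_tJoins_eq_card_evenSubgraphs G hF₀, div_self hE, mul_one,
      div_mul_cancel₀ _ hZ.ne']
  · have hmem : (↑ω : Literature.Probability.Percolation.BondConfig V) ∉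
        Literature.Probability.Percolation.openConn x y := hr
    have hempty : tJoins G (↑ω : Set (Sym2 V)) {x, y} = ∅ := by
      by_contra hne
      exact hr ((tJoins_pair_nonempty_iff G ω hωE hxy).1 (Finset.nonempty_iff_ne_empty.2 hne))
    rw [if_neg hmem, hempty, Finset.card_empty, Nat.cast_zero, zero_div, mul_zero, zero_mul]

/-- **The parity robustness in loop form** (`∫ u_a dφ · Z_RC = 2^{|V|}(1 − p/2)^{|E|} · Z_t(A; C)`,
`t = p/(2 − p)`): the expectation of the crux's `u_a` (fraction of the `T`-joins of `A = {aᵢ}` inside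
`ω` keeping `A` in one component; the crux's `Finset`-monad coercion included) is the loop-O(1) mass of
the joined `T`-joins, for EVERY `a : Fin 4 → V` (no injectivity needed on this side). [cite: GrimmettJanson2007, Thm 3.1] -/
theorem integral_u_mul_Z {p : ℝ} (hp : p ∈ Set.Icc (0 : ℝ) 1) (a : Fin 4 → V) :
    (let sol : Set (Sym2 V) → Finset (Finset (Sym2 V)) := fun ω => G.edgeFinset.powerset.filter (fun F => (↑F : Set (Sym2 V)) ⊆ ω ∧ ∀ v, Odd (F.filter (fun e => v ∈ e)).card ↔ v ∈ Finset.univ.image a); let u : Set (Sym2 V) → ℝ := fun ω => (((sol ω).filter (fun F => ∀ i j, (SimpleGraph.fromEdgeSet (↑F : Set (Sym2 V))).Reachable (a i) (a j))).card : ℝ) / ((sol ω).card : ℝ);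
      (∫ ω, u ω ∂(rcMeasure G p 2 ∅)) * rcPartitionFunction G p 2 ∅ =
        2 ^ Fintype.card V * (1 - p / 2) ^ #G.edgeFinset * zMass G (p / (2 - p)) a (fun F => JoinsAll a F)) := by
  intro sol u
  have h2 : (0 : ℝ) < 2 := two_pos
  have hZ := rcPartitionFunction_pos G hp h2 (∅ : Set V)
  have hsol : ∀ ω : Set (Sym2 V), sol ω = tJoins G ω (univ.image a) := fun ω => rfl
  have hu : ∀ ω, u ω =
      (#((tJoins G ω (univ.image a)).filter fun F => JoinsAll a F) : ℝ) / #(evenSubgraphs G ω) := by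
    intro ω
    simp only [u]
    rw [hsol ω, card_filter_bind_pure_coe _ _ (fun F => JoinsAll a F) (fun F => Iff.rfl)]
    rcases (tJoins G ω (univ.image a)).eq_empty_or_nonempty with hemp | ⟨F₀, hF₀⟩
    · rw [hemp]
      simp
    · rw [card_tJoins_eq_card_evenSubgraphs G hF₀]
  have hGJ := grimmettJanson_identity G (fun ω hω => card_evenSubgraphs_mul_two_pow G ω hω) hp
    (univ.image a) (fun F => JoinsAll a F)
  rw [integral_rcMeasure G hp h2 ∅ u, Finset.sum_mul]
  unfold zMass
  rw [← hGJ]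
  refine Finset.sum_congr rfl fun ω _ => ?_
  rw [hu]
  field_simp

/-- Rewriting the route's inlined loop sums (`SourceTrailsMeet`'s `Z S P`) through the tree's `tJoins`. [folklore] -/
theorem sum_filter_parity_eq (t : ℝ) (S : Finset V) (P : Finset (Sym2 V) → Prop) :
    (∑ F ∈ G.edgeFinset.powerset.filter
        (fun F => (∀ v, Odd (F.filter (fun e => v ∈ e)).card ↔ v ∈ S) ∧ P F), t ^ F.card) =
      ∑ F ∈ (tJoins G Set.univ S).filter (fun F => P F), t ^ #F := by
  refine Finset.sum_congr ?_ fun _ _ => rfl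
  ext F
  simp only [Finset.mem_filter, Finset.mem_powerset, mem_tJoins, Set.subset_univ, true_and, and_assoc]

/-- **The transfer in the falsifying direction (one finite graph).**  On any finite graph `G`, at any
`β ≥ 0`, for four DISTINCT marked vertices `a` and `c_B ≥ 0`: if BLOB's inequality
`c_B · φ[all aᵢ joined] ≤ ∫ u_a dφ` and P4's inequality `c_P · φ(a₀↔a₁) φ(a₂↔a₃) ≤ φ[all aᵢ joined]` both
hold for `φ = φ^free_{G, 1−e^{−2β}, 2}`, then the loop-O(1) inequality of `SourceTrailsMeet` holds with
`c = c_B c_P`:  `c_B c_P · Z_t({a₀,a₁}) Z_t({a₂,a₃}) ≤ Z_t(∅) · Z_t(A; all joined)`, `t = tanh β`.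
Ingredients: the sourced Grimmett–Janson identity (landed, `grimmettJanson_identity` +
`card_evenSubgraphs_mul_two_pow`) read three ways — `rcPartitionFunction_two_eq_loop` (`A = ∅`),
`rcMeasure_real_openConn_mul_Z` (`A = {x,y}`), `integral_u_mul_Z` (`A = {aᵢ}`, `P = C`) — and
cancellation of the common factor `(2^{|V|}(1−p/2)^{|E|}/Z_RC)² > 0`. [cite: GrimmettJanson2007, Thm 3.1] -/
theorem loop_bound_of_fk_bounds {β : ℝ} (hβ : 0 ≤ β) (a : Fin 4 → V) (ha : Function.Injective a)
    {cB cP : ℝ} (hcB : 0 ≤ cB) :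
    (let φ := Literature.Probability.LatticeModels.rcMeasure G (Literature.Probability.LatticeModels.fkIsingParam β) 2 ∅; let sol : Set (Sym2 V) → Finset (Finset (Sym2 V)) := fun ω => G.edgeFinset.powerset.filter (fun F => (↑F : Set (Sym2 V)) ⊆ ω ∧ ∀ v, Odd (F.filter (fun e => v ∈ e)).card ↔ v ∈ Finset.univ.image a); let u : Set (Sym2 V) → ℝ := fun ω => (((sol ω).filter (fun F => ∀ i j, (SimpleGraph.fromEdgeSet (↑F : Set (Sym2 V))).Reachable (a i) (a j))).card : ℝ) / ((sol ω).card : ℝ);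
      cB * φ.real {ω | ∀ i j, (Literature.Probability.Percolation.openGraph ω).Reachable (a i) (a j)} ≤ ∫ ω, u ω ∂φ →
      cP * φ.real (Literature.Probability.Percolation.openConn (a 0) (a 1)) *
          φ.real (Literature.Probability.Percolation.openConn (a 2) (a 3)) ≤
        φ.real {ω | ∀ i j, (Literature.Probability.Percolation.openGraph ω).Reachable (a i) (a j)} →
      cB * cP * (∑ F ∈ tJoins G Set.univ ({a 0, a 1} : Finset V), Real.tanh β ^ #F) *
          (∑ F ∈ tJoins G Set.univ ({a 2, a 3} : Finset V), Real.tanh β ^ #F) ≤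
        (∑ F ∈ tJoins G Set.univ (∅ : Finset V), Real.tanh β ^ #F) *
          zMass G (Real.tanh β) a (fun F => JoinsAll a F)) := by
  intro φ sol u hB hP
  have hp : fkIsingParam β ∈ Set.Icc (0 : ℝ) 1 := fkIsingParam_mem_Icc hβ
  have ht : Real.tanh β = fkIsingParam β / (2 - fkIsingParam β) := tanh_eq_fkIsingParam_div β
  have h2 : (0 : ℝ) < 2 := two_pos
  have hZ := rcPartitionFunction_pos G hp h2 (∅ : Set V)
  set M : ℝ := 2 ^ Fintype.card V * (1 - fkIsingParam β / 2) ^ #G.edgeFinset with hM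
  have hM0 : 0 < M := by
    have : 0 < 1 - fkIsingParam β / 2 := by linarith [hp.2]
    positivity
  -- the four dictionary entries
  have e0 : rcPartitionFunction G (fkIsingParam β) 2 ∅ =
      M * ∑ F ∈ tJoins G Set.univ (∅ : Finset V), Real.tanh β ^ #F := by
    rw [ht]; exact rcPartitionFunction_two_eq_loop G hp
  have e01 : φ.real (Literature.Probability.Percolation.openConn (a 0) (a 1)) *
      rcPartitionFunction G (fkIsingParam β) 2 ∅ =
      M * ∑ F ∈ tJoins G Set.univ ({a 0, a 1} : Finset V), Real.tanh β ^ #F := by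
    rw [ht]; exact rcMeasure_real_openConn_mul_Z G hp (ha.ne (by decide))
  have e23 : φ.real (Literature.Probability.Percolation.openConn (a 2) (a 3)) *
      rcPartitionFunction G (fkIsingParam β) 2 ∅ =
      M * ∑ F ∈ tJoins G Set.univ ({a 2, a 3} : Finset V), Real.tanh β ^ #F := by
    rw [ht]; exact rcMeasure_real_openConn_mul_Z G hp (ha.ne (by decide))
  have eC : (∫ ω, u ω ∂φ) * rcPartitionFunction G (fkIsingParam β) 2 ∅ =
      M * zMass G (Real.tanh β) a (fun F => JoinsAll a F) := by
    rw [ht]; exact integral_u_mul_Z G hp a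
  -- chain the two FK inequalities
  have key : cB * cP * φ.real (Literature.Probability.Percolation.openConn (a 0) (a 1)) *
      φ.real (Literature.Probability.Percolation.openConn (a 2) (a 3)) ≤ ∫ ω, u ω ∂φ := by
    have h := mul_le_mul_of_nonneg_left hP hcB
    calc cB * cP * φ.real (Literature.Probability.Percolation.openConn (a 0) (a 1)) *
          φ.real (Literature.Probability.Percolation.openConn (a 2) (a 3))
          = cB * (cP * φ.real (Literature.Probability.Percolation.openConn (a 0) (a 1)) *
              φ.real (Literature.Probability.Percolation.openConn (a 2) (a 3))) := by ring
      _ ≤ cB * φ.real {ω | ∀ i j, (Literature.Probability.Percolation.openGraph ω).Reachable (a i) (a j)} := h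
      _ ≤ ∫ ω, u ω ∂φ := hB
  -- transfer: multiply by `Z_RC² / M²`
  set Zrc := rcPartitionFunction G (fkIsingParam β) 2 ∅ with hZrc
  set Z0 := ∑ F ∈ tJoins G Set.univ (∅ : Finset V), Real.tanh β ^ #F
  set Z01 := ∑ F ∈ tJoins G Set.univ ({a 0, a 1} : Finset V), Real.tanh β ^ #F
  set Z23 := ∑ F ∈ tJoins G Set.univ ({a 2, a 3} : Finset V), Real.tanh β ^ #F
  set ZC := zMass G (Real.tanh β) a (fun F => JoinsAll a F)
  set φ01 := φ.real (Literature.Probability.Percolation.openConn (a 0) (a 1))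
  set φ23 := φ.real (Literature.Probability.Percolation.openConn (a 2) (a 3))
  set I := ∫ ω, u ω ∂φ
  have f0 : Z0 = Zrc / M := by
    rw [e0]; field_simp
  have f01 : Z01 = φ01 * Zrc / M := by
    rw [eq_div_iff hM0.ne']; linarith [e01]
  have f23 : Z23 = φ23 * Zrc / M := by
    rw [eq_div_iff hM0.ne']; linarith [e23]
  have fC : ZC = I * Zrc / M := by
    rw [eq_div_iff hM0.ne']; linarith [eC]
  calc cB * cP * Z01 * Z23 = (cB * cP * φ01 * φ23) * (Zrc ^ 2 / M ^ 2) := by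
        rw [f01, f23]; field_simp
    _ ≤ I * (Zrc ^ 2 / M ^ 2) := mul_le_mul_of_nonneg_right key (by positivity)
    _ = Z0 * ZC := by
        rw [f0, fC]; field_simp

end General

/-! ## BLOB ∧ P4 dies with the loop connection probability -/

/-- **`¬ SourceTrailsMeet → ¬ (ParityRobustMerging ∧ FKFourConnectivity)`** (equivalently
`ParityRobustMerging → FKFourConnectivity → SourceTrailsMeet`, filed contraposed as negative
knowledge).  Proof: BLOB and P4 at `(l, N ≥ max N₀ᴮ N₀ᴾ, a = l·tetra)` feed `loop_bound_of_fk_bounds`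
on the box graph `G_N = (zdGraph 3).comap val` at `β = β_c(3) ≥ 0` (`criticalBeta_nonneg`), `a`
injective (`tetra_injective`); the conclusion is `SourceTrailsMeet`'s inner statement with
`c = c_B c_P` (`sum_filter_parity_eq`). [cite: GrimmettJanson2007, Thm 3.1] -/
theorem not_blob_and_p4_of_not_sourceTrailsMeet
    (hS : ¬ Summit.CriticalPhenomena.Ising3DConformalLimit.Theses.FKParityRobustness.SourceTrailsMeet) :
    ¬ (Summit.CriticalPhenomena.Ising3DConformalLimit.Theses.FKParityRobustness.ParityRobustMerging ∧
       Summit.CriticalPhenomena.Ising3DConformalLimit.Theses.FKParityRobustness.FKFourConnectivity) := by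
  rintro ⟨hBLOB, hP4⟩
  apply hS
  obtain ⟨cB, hcB, hB⟩ := hBLOB
  obtain ⟨cP, hcP, hP⟩ := hP4
  unfold Summit.CriticalPhenomena.Ising3DConformalLimit.Theses.FKParityRobustness.SourceTrailsMeet
  intro tetra'
  refine ⟨cB * cP, mul_pos hcB hcP, fun l hl => ?_⟩
  obtain ⟨N₁, hN₁⟩ := hB l hl
  obtain ⟨N₂, hN₂⟩ := hP l hl
  refine ⟨max N₁ N₂, fun N hN a ha => ?_⟩
  have h1 := hN₁ N (le_of_max_le_left hN) a ha
  have h2 := hN₂ N (le_of_max_le_right hN) a ha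
  have key := loop_bound_of_fk_bounds ((zdGraph 3).comap (Subtype.val : ↥(box 3 N) → Site 3))
    (criticalBeta_nonneg 3) a (tetra_injective hl a ha) hcB.le h1 h2
  dsimp only
  rw [sum_filter_parity_eq, sum_filter_parity_eq, sum_filter_parity_eq, sum_filter_parity_eq,
    Finset.filter_true, Finset.filter_true, Finset.filter_true]
  exact key

end Summit.CriticalPhenomena.Ising3DConformalLimit.Theorems.FKFourConnectivity.Negative

end
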